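import Summits.BirchSwinnertonDyer.Rank1Residual.P2.CongruentNumberSilentEvenFiveThetaDescentRank
import Summits.BirchSwinnertonDyer.Rank1Residual.P2.CongruentNumberPairsAtTwoEvenRungTwo
import Summits.BirchSwinnertonDyer.Rank1Residual.P2.CongruentNumberSilentEvenFiveGenusParity
import Summits.BirchSwinnertonDyer.Rank1Residual.P2.CongruentNumberSilentEvenFiveThetaDescentAoki
import Literature.NumberTheory.QuadraticFields.RedeiReichardtFourRank
import HarnessLib

/-!
# Cell «bsd-monsky» (typer): THE `k = 2` RUNG OF THE UNIFORM EVEN MONSKY LAW C-P2-2 FROM ROUTE B —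
# `CongruentSilentEvenBSDTwoAt 2` relative to {`hΘ`, `hR`, `hMe`} and `CongruentEvenBSDTwoAt 2` relative to
# {U⁺, GZK, `hΘ`, `hR`, `hMe`}; §2: Rédei–Reichardt DISCHARGED and the `2`-Selmer input re-sourced from Aoki 1999 —
# `CongruentSilentEvenBSDTwoAt 2` relative to {`hΘ`, `hAo`} alone

HONEST FRAMING: nothing asserted; conditional on the summit obligation node `thetaGenusPointDatum` (`hΘ`, a displayed
`@[conjecture]` datum of TYZ's θ-package, not a Literature fact), Rédei–Reichardt (`hR`), Monsky's even matrix (`hMe`;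
Heath-Brown 1994, Appendix (Monsky), even case, printed as a sketch proof, pp. 368–369) and, for the loud cells, U⁺ (`hU`,
TYZ Thm. 1.2 in its `ρ`-free form, the binder of DOOR B6) and `hGZK`. The rung bookkeeping is the sub-lane's landed
`P2/CongruentNumberPairsAtTwoEvenRungTwo.lean`; the 𝒮⁻ theorem is prover-B's landed route-B enclosure
(`…ThetaDescentRank.lean`, p403392). Sibling of `…EnclosureRungTwo.lean` (route A). Rungs `k ≥ 3` are NOT touched. Nothing booked.
§2 (typer g3): Rédei–Reichardt is a tree THEOREM (`RedeiReichardt.redeiReichardt_fourTwoCard_classGroup_holds`, p405187), so the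
`hR` binders of §1 are discharged by instantiation, and the `2`-Selmer input can be Aoki 1999 Thm. 2.2 (`hAo`, refereed,
complete printed proofs; prover-B's `…ThetaDescentAoki.lean`, p406801) in place of `hMe` — the silent rung from {`hΘ`, `hAo`}
(or {`thetaCMDatum` (D1)–(D7), `hAo`}), the route-B sibling of `…EnclosureAokiBridged.lean`'s
`congruentSilentEvenBSDTwoAt_two_of_bridgedSystem_of_aoki`. One-line compositions; nothing booked.
-/

noncomputable section

open scoped Classical

open WeierstrassCurve NumberField Literature.NumberTheory.EllipticCurves
  Literature.NumberTheory.EllipticCurves.Rank1Residual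
  Literature.NumberTheory.EllipticCurves.Rank1Residual.Typed
  Literature.NumberTheory.EllipticCurves.TianYuanZhang2017
  Literature.NumberTheory.EllipticCurves.HeathBrown1994
  Literature.NumberTheory.QuadraticFields.RedeiReichardt

set_option autoImplicit false

namespace Summit.BirchSwinnertonDyer.Rank1Residual.P2

open Conjectures

/-- **THE SILENT `k = 2` RUNG from route B** — modulo the obligation node `thetaGenusPointDatum` (`hΘ`), Rédei–Reichardt
and `hMe`; no GZK binder, no Monsky 1990 binder. Conditional; nothing asserted.
[cite: Monsky1990MockHeegner, Remark (3) (p. 67)] [cite: TianYuanZhang2017, Thm. 1.2, Thm. 3.5] [cite: HeathBrown1994SelmerCongruentII, Appendix (Monsky)] -/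
theorem congruentSilentEvenBSDTwoAt_two_of_thetaGenusPointDatum_of_monskyEven
    (hΘ : ∀ p q : ℕ, p.Prime → q.Prime → p % 8 = 5 → q % 4 = 3 → thetaGenusPointDatum p q)
    (hR : redeiReichardt_fourTwoCard_classGroup) (hMe : monsky_card_selmerGroup_two_even) :
    CongruentSilentEvenBSDTwoAt 2 :=
  congruentSilentEvenBSDTwoAt_two_of_congruentSilentEvenFiveBSDTwo hR
    (congruentSilentEvenFiveBSDTwo_of_thetaGenusPointDatum_of_monskyEven hΘ hR hMe)

/-- **THE `k = 2` RUNG `CongruentEvenBSDTwoAt 2` from route B** — modulo {U⁺, GZK (loud cells, DOOR B6 over census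
vocabulary), `hΘ`, `hR`, `hMe`}. Conditional; nothing asserted.
[cite: Monsky1990MockHeegner, Remark (3) (p. 67)] [cite: TianYuanZhang2017, Thm. 1.2, Thm. 3.5]
[cite: HeathBrown1994SelmerCongruentII, Appendix (Monsky)] [cite: Miller2011LMS, Def. 1.1 (arXiv:1010.2431 p. 3)] -/
theorem congruentEvenBSDTwoAt_two_of_thetaGenusPointDatum_of_monskyEven
    (hU : ∀ (n : ℕ), Squarefree n → (n % 8 = 5 ∨ n % 8 = 6 ∨ n % 8 = 7) →
      ∃ L : ℤ, IsScriptL n L ∧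
        ((n % 8 = 5 ∨ n % 8 = 7) → (2 : ℤ) ∣ L →
          Even (genusSum₁ n fun d => genusClassNumber (GenusField d)) ∧
          Even (genusSum₂' n fun d => genusClassNumber (GenusField d))) ∧
        (n % 8 = 6 → (2 : ℤ) ∣ L → Even (genusSum₂' n fun d => genusClassNumber (GenusField d))))
    (hGZK : rank_eq_analyticRank_of_analyticRank_le_one)
    (hΘ : ∀ p q : ℕ, p.Prime → q.Prime → p % 8 = 5 → q % 4 = 3 → thetaGenusPointDatum p q)
    (hR : redeiReichardt_fourTwoCard_classGroup) (hMe : monsky_card_selmerGroup_two_even) :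
    CongruentEvenBSDTwoAt 2 :=
  congruentEvenBSDTwoAt_two_of_congruentSilentEvenFiveBSDTwo hU hGZK hMe hR
    (congruentSilentEvenFiveBSDTwo_of_thetaGenusPointDatum_of_monskyEven hΘ hR hMe)

/-! ## §2 Rédei–Reichardt DISCHARGED (`redeiReichardt_fourTwoCard_classGroup_holds`, p405187) and the `2`-Selmer input
re-sourced from Aoki 1999 Thm. 2.2 (`hAo`; prover-B's `…ThetaDescentAoki.lean`, p406801) — the silent rung from
{`hΘ`, `hAo`} alone; the `hMe` forms without `hR` -/

open Literature.NumberTheory.EllipticCurves.Aoki1999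

/-- **THE SILENT `k = 2` RUNG from route B, relative to {`hΘ`, `hAo`} ALONE** — the obligation node `thetaGenusPointDatum`
and Aoki 1999 Thm. 2.2; Rédei–Reichardt instantiated by the tree theorem `redeiReichardt_fourTwoCard_classGroup_holds`
(silence of the `𝒮⁻` cells); no `hMe`, no GZK binder, no Monsky 1990 binder. Conditional; nothing asserted.
[cite: Monsky1990MockHeegner, Remark (3) (p. 67)] [cite: TianYuanZhang2017, Thm. 1.2, Thm. 3.5] [cite: Aoki1999, Thm. 2.2 (p. 81)]
[cite: RedeiReichardt1934, Satz (pp. 69–74)] -/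
theorem congruentSilentEvenBSDTwoAt_two_of_thetaDisplay_of_aoki
    (hΘ : ∀ p q : ℕ, p.Prime → q.Prime → p % 8 = 5 → q % 4 = 3 → thetaGenusPointDatum p q)
    (hAo : thm22_card_selmerGroup_two) : CongruentSilentEvenBSDTwoAt 2 :=
  congruentSilentEvenBSDTwoAt_two_of_congruentSilentEvenFiveBSDTwo redeiReichardt_fourTwoCard_classGroup_holds
    (congruentSilentEvenFiveBSDTwo_of_thetaDisplay_of_aoki hΘ hAo)

/-- **THE SILENT `k = 2` RUNG from {`thetaCMDatum` (D1)–(D7), `hAo`}** — the display pushed down to the CM points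
(`thetaGenusPointDatum_of_thetaCMDatum`); the form quoted in the cell's fact-set tables. Conditional; nothing asserted.
[cite: Monsky1990MockHeegner, Remark (3) (p. 67)] [cite: TianYuanZhang2017, Prop. 3.2 (2), Thm. 3.6 (1)(2), Lemma 3.18, Thm. 3.5]
[cite: Aoki1999, Thm. 2.2 (p. 81)] [cite: RedeiReichardt1934, Satz (pp. 69–74)] -/
theorem congruentSilentEvenBSDTwoAt_two_of_thetaCMDatum_of_aoki
    (hΘ : ∀ p q : ℕ, p.Prime → q.Prime → p % 8 = 5 → q % 4 = 3 → thetaCMDatum p q)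
    (hAo : thm22_card_selmerGroup_two) : CongruentSilentEvenBSDTwoAt 2 :=
  congruentSilentEvenBSDTwoAt_two_of_congruentSilentEvenFiveBSDTwo redeiReichardt_fourTwoCard_classGroup_holds
    (congruentSilentEvenFiveBSDTwo_of_thetaCMDatum_of_aoki hΘ hAo)

/-- **THE SILENT `k = 2` RUNG from {`hΘ`, `hMe`}, Rédei–Reichardt discharged** (§1's
`congruentSilentEvenBSDTwoAt_two_of_thetaGenusPointDatum_of_monskyEven` without its `hR` binder, through prover-B's
`hR`-free door `congruentSilentEvenFiveBSDTwo_of_thetaDisplay_of_monskyEven`). Conditional; nothing asserted.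
[cite: Monsky1990MockHeegner, Remark (3) (p. 67)] [cite: TianYuanZhang2017, Thm. 1.2, Thm. 3.5]
[cite: HeathBrown1994SelmerCongruentII, Appendix (Monsky)] [cite: RedeiReichardt1934, Satz (pp. 69–74)] -/
theorem congruentSilentEvenBSDTwoAt_two_of_thetaDisplay_of_monskyEven
    (hΘ : ∀ p q : ℕ, p.Prime → q.Prime → p % 8 = 5 → q % 4 = 3 → thetaGenusPointDatum p q)
    (hMe : monsky_card_selmerGroup_two_even) : CongruentSilentEvenBSDTwoAt 2 :=
  congruentSilentEvenBSDTwoAt_two_of_congruentSilentEvenFiveBSDTwo redeiReichardt_fourTwoCard_classGroup_holds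
    (congruentSilentEvenFiveBSDTwo_of_thetaDisplay_of_monskyEven hΘ hMe)

/-- **THE `k = 2` RUNG `CongruentEvenBSDTwoAt 2` from {U⁺, GZK, `hΘ`, `hMe`}, Rédei–Reichardt discharged** — silent cells
by route B, loud cells by DOOR B6 over census vocabulary (`hMe` enters there as the currency of the cell condition
`s(n) = 1`). Conditional; nothing asserted.
[cite: Monsky1990MockHeegner, Remark (3) (p. 67)] [cite: TianYuanZhang2017, Thm. 1.2, Thm. 3.5]
[cite: HeathBrown1994SelmerCongruentII, Appendix (Monsky)] [cite: Miller2011LMS, Def. 1.1 (arXiv:1010.2431 p. 3)]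
[cite: RedeiReichardt1934, Satz (pp. 69–74)] -/
theorem congruentEvenBSDTwoAt_two_of_thetaDisplay_of_monskyEven
    (hU : ∀ (n : ℕ), Squarefree n → (n % 8 = 5 ∨ n % 8 = 6 ∨ n % 8 = 7) →
      ∃ L : ℤ, IsScriptL n L ∧
        ((n % 8 = 5 ∨ n % 8 = 7) → (2 : ℤ) ∣ L →
          Even (genusSum₁ n fun d => genusClassNumber (GenusField d)) ∧
          Even (genusSum₂' n fun d => genusClassNumber (GenusField d))) ∧
        (n % 8 = 6 → (2 : ℤ) ∣ L → Even (genusSum₂' n fun d => genusClassNumber (GenusField d))))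
    (hGZK : rank_eq_analyticRank_of_analyticRank_le_one)
    (hΘ : ∀ p q : ℕ, p.Prime → q.Prime → p % 8 = 5 → q % 4 = 3 → thetaGenusPointDatum p q)
    (hMe : monsky_card_selmerGroup_two_even) : CongruentEvenBSDTwoAt 2 :=
  congruentEvenBSDTwoAt_two_of_congruentSilentEvenFiveBSDTwo hU hGZK hMe redeiReichardt_fourTwoCard_classGroup_holds
    (congruentSilentEvenFiveBSDTwo_of_thetaDisplay_of_monskyEven hΘ hMe)

end Summit.BirchSwinnertonDyer.Rank1Residual.P2

end
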